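import Summits.HodgeConjecture.HodgeCM.Model.HypCensus.ArchFactor_1
import Literature.NumberTheory.Li1992.ThetaLiftCharacterArchFinReduction
import Literature.NumberTheory.GelbartRogawski1991.UnitaryDualPairWeilCoinvariants
import Literature.NumberTheory.Weil1964.AdelicMetaplecticReindex
import HarnessLib

/-!
# P4-S4′(ii): the factorisation `ω_ψ ∘ s_pair |_{U(W)(𝔸)} = ω_∞ ⊗ ω_f` (hypothesis `hω` of the non-vanishing reduction), DISCHARGED

Topic: summit `HodgeConjecture`, sub-problem `HodgeConjecture`, crux H413 (stmt-HodgeConjecture-24833), FLOOR-0 programme P4,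
line `Cruxes/H413/Lines/F0_P4AdmissibleOccursInH1.lean`, stub S4′ `stub_T3a_holThetaRealisationOfRallisAt` — its NON-VANISHING
half (seat (ii)).  Namespace `Summit.HodgeConjecture.HodgeConjecture.Cruxes.H413.ThetaNonvanishing`.  KERNEL: theorems only.

★ `Li1992/ThetaLiftCharacterArchFinReduction` (`UnitaryDualPair.thetaLift_charCM_tmul_ne_zero_of_finCoeff_ne_zero`) reduces
`Θ_{Φ_∞ ⊗ Φ_f}(χ̃) ≠ 0` — given Rallis' identity (26) of [Li1992, Thm 2.1] for the pair's theta-kernel datum — to ONE non-zero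
finite Fourier coefficient, UNDER the displayed hypothesis `hω`: on `U(W)(𝔸) = U(W)(E⊗ℝ)·U(W)(𝔸_{F,f})` the adelic Weil
representation `ω_ψ ∘ s_pair` acts on factorizable vectors factor by factor ([Weil1964, Chap. III n° 37–38]: `𝐫_𝐀 = ⊗_v 𝐫_v`).
This file PROVES `hω` for every compatible splitting `s` of every unitary dual pair of the tree, from the two halves the
tree already holds:

* archimedean half: the model's ★ `HodgeCM.Model.HypCensus.archWeilRep … s hs` with `omega_pairSplitting_arch_map_tmul`
  (`ω_ψ(s_pair(x_∞, y_∞))(Φ_∞ ⊗ Φ_f) = archWeilRep (x,y) Φ_∞ ⊗ Φ_f`, over `Weil1964.archRepMp` — the archimedean pair elements fix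
  the finite Heisenberg elements, `hfin_pairSplitting_arch`);
* finite half: ★ `UnitaryDualPair.WeilCoinv.pairRep_finPairToAdelic_piSBReindex_tmul` (`(ω_ψ ∘ s_pair)(1_∞·k_f, 1_∞·u_f)` acts by
  `1 ⊗ finPairRep hs (k,u)` in the Kronecker currency `𝒮(𝔸^{N×M})`, read in `𝒮(𝔸^n)` through `piSBReindex F e` = `R_e^∞ ⊗ R_e^f`
  on pure tensors, ★ `piSBReindex_tmul`).

* §1 `pairRep_one_archToAdelic_tmul` / `pairRep_one_finAdelicToAdelic_tmul` / **`pairRep_one_archToAdelic_mul_finAdelicToAdelic_tmul`**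
  — `hω` with `ω_∞ a := archWeilRep (1, a)` and `ω_f b := R_e^f ∘ finPairRepW hs b ∘ (R_e^f)⁻¹`;
* §2 **`thetaLift_charCM_tmul_ne_zero_of_finCoeff_ne_zero`** — the ★ reduction with `hω` DISCHARGED: for the pair's datum
  `M = UnitaryDualPair.thetaKernelDatum … s hs hρ SK hSK`, Rallis' identity `hR` ∧ the character reading `hχw` ∧ an archimedean
  `archWeilRep`-eigenvector `Φ_∞` (`⟨Φ_∞, Ψ_∞⟩_∞ ≠ 0`) ∧ ONE non-zero finite coefficient
  `∫_{U(W)(𝔸_f)} ⟨R_e^f (finPairRepW hs b ((R_e^f)⁻¹ Φ_f)), Ψ_f⟩_f · w_f(b) db ≠ 0` ⟹ `Θ_{Φ_∞ ⊗ Φ_f}(χ̃) ≠ 0` (and `Θ_{Ψ_∞ ⊗ Ψ_f}(χ̃) ≠ 0`).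
  At the pin of [Liu2021, Prop. 4.13] (`N = 3`, `M = 1`, `F = L⁺`, `E = L`, `J_W = J_W(a)`, `s = s_μ(a)`) the remaining inputs are
  therefore: S6 (`stub_rallisInnerProductFormula`), the reading of Liu's `χ ∈ Chi` as `χ̃` (filed
  `Liu2021/Def411ChiAutomorphicQuotient`, `conj_coe_chiQuot_mk` gives `hχw` with `χ_∞ = 1`), the harmonic archimedean vector FIXED by
  `U(W)(L⁺⊗ℝ)` under `archWeilRep`, and the finite non-vanishing ([Li1992, (27) and §5] / local occupancy).

HC_CM is proved only modulo the printed citations until rung 0 closes; this file proves nothing printed.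

## References
* [Li1992] J.-S. Li, J. reine angew. Math. 428 (1992), Thm 2.1 (26)–(27) p. 184; §5.
* [Weil1964] A. Weil, Acta Math. 111 (1964), Chap. III n° 37–39 (`𝐫_𝐀 = ⊗_v 𝐫_v`), n° 41.
* [Liu2021] Y. Liu, Camb. J. Math. 9 (2021), proof of Prop. 4.13 (l. 2145); App. D Lem. D.2 (2).
* [GelbartRogawski1991] S. Gelbart, J. Rogawski, Invent. Math. 105 (1991), §3.1 Prop. 3.1.1.
-/

set_option autoImplicit false
set_option linter.dupNamespace false

noncomputable section

open _root_.MeasureTheory NumberField NumberField.mixedEmbedding IsDedekindDomain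
open scoped ComplexConjugate TensorProduct SchwartzMap NNReal Classical
open Literature.NumberTheory.Automorphic Literature.NumberTheory.Weil1964 Literature.NumberTheory.Li1992
open Literature.NumberTheory.GelbartRogawski1991 Literature.NumberTheory.GelbartRogawski1991.UnitaryDualPair
open Literature.RepresentationTheory.CompactGroups
open HodgeCM.Model.HypCensus

namespace Summit.HodgeConjecture.HodgeConjecture.Cruxes.H413.ThetaNonvanishing

variable (F E : Type) [Field F] [NumberField F] [Field E] [NumberField E] [Algebra F E]
variable (c : E ≃ₐ[F] E) (N M : ℕ) {n : ℕ} (e : Fin N × Fin M ≃ Fin n)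
variable (JV : Matrix (Fin N) (Fin N) E) (JW : Matrix (Fin M) (Fin M) E)
variable {TV : Matrix (Fin N) (Fin N) F} {TW : Matrix (Fin M) (Fin M) F}
variable [Algebra.IsQuadraticExtension F E] {δ : E} (hcδ : c δ = -δ) (hδ : δ ≠ 0) {d : F}
  (hd : δ * δ = algebraMap F E d) (hV : TV.IsSymm) (hW : TW.IsSymm) (hVd : IsUnit TV.det) (hWd : IsUnit TW.det)
  (hJV : JV = TV.map (algebraMap F E)) (hJW : JW = TW.map (algebraMap F E))
variable {s : UnitaryGroup.adelicPair F E c N M JV JW →* adelicMpCont F (Fin n) (adelicGram F e TV TW)}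
  (hs : (splittingDatum F E c N M e JV JW hcδ hδ hd hV hW hVd hWd hJV hJW).IsCompatible s)

/-! ## §1 The archimedean and finite halves on pure tensors of `𝒮(𝔸_Fⁿ)`, and `hω` -/

/-- a compatible splitting lies over `toSp` (the hypothesis `hs` of the model's `archWeilRep`, in its syntactic form).
[cite: GelbartRogawski1991, §3.1 Prop. 3.1.1] -/
theorem proj_apply_eq_toSp (hs : (splittingDatum F E c N M e JV JW hcδ hδ hd hV hW hVd hWd hJV hJW).IsCompatible s)
    (g : UnitaryGroup.adelicPair F E c N M JV JW) :
    adelicMpCont.proj F (Fin n) (adelicGram F e TV TW) (s g) = toSp F E c N M e JV JW hcδ hδ hd hV hW hJV hJW g :=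
  hs.1 g

/-- **archimedean half**: `ω_ψ(s_pair(1, (a, 1_f)))(Φ_∞ ⊗ Φ_f) = archWeilRep s (1, a) Φ_∞ ⊗ Φ_f` (the model's ★ read-off of the
archimedean factor through `archRepMp`; the archimedean pair elements fix the finite Heisenberg elements).
[cite: Weil1964, Chap. III n° 37–38] -/
theorem pairRep_one_archToAdelic_tmul (a : UnitaryGroup.arch F E c M JW) (Φinf : 𝓢((Fin n → mixedSpace F), ℂ))
    (Φfin : FinSB F (Fin n)) :
    pairRep F E c N M e JV JW s (1, UnitaryGroup.archToAdelic F E c M JW a) (piSchwartzBruhatEquiv F (Fin n) (Φinf ⊗ₜ Φfin)) =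
      piSchwartzBruhatEquiv F (Fin n)
        (archWeilRep F E c N M JV JW hcδ hδ hd hV hW hVd hWd hJV hJW e s
          (proj_apply_eq_toSp F E c N M e JV JW hcδ hδ hd hV hW hVd hWd hJV hJW hs) (1, a) Φinf ⊗ₜ Φfin) := by
  have h1 : ((1 : UnitaryGroup.adelic F E c N JV), (UnitaryGroup.archToAdelic F E c M JW a : UnitaryGroup.adelic F E c M JW)) =
      archProdHom F E c N M JV JW (1, a) :=
    Prod.ext (by change (1 : UnitaryGroup.adelic F E c N JV) = UnitaryGroup.archToAdelic F E c N JV 1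
                 exact (map_one _).symm) rfl
  have key := omega_pairSplitting_arch_map_tmul F E c N M JV JW hcδ hδ hd hV hW hVd hWd hJV hJW e s
    (proj_apply_eq_toSp F E c N M e JV JW hcδ hδ hd hV hW hVd hWd hJV hJW hs) (1, a) Φinf Φfin
  rw [← pairRep_apply] at key
  exact (congrArg (fun p => pairRep F E c N M e JV JW s p (piSchwartzBruhatEquiv F (Fin n) (Φinf ⊗ₜ Φfin))) h1).trans key

/-- `R_e^∞ (R_{e⁻¹}^∞ Φ) = Φ` on the archimedean Schwartz space. [folklore] -/
private theorem schwartzReindexCLM_symm_apply (Φinf : 𝓢((Fin n → mixedSpace F), ℂ)) :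
    schwartzReindexCLM F e (schwartzReindexCLM F e.symm Φinf) = Φinf := by
  ext w
  rw [schwartzReindexCLM_apply, schwartzReindexCLM_apply]
  congr 1
  funext i
  simp

/-- **finite half**: `ω_ψ(s_pair(1, (1_∞, b)))(Φ_∞ ⊗ Φ_f) = Φ_∞ ⊗ R_e^f (finPairRep hs (1, b) ((R_e^f)⁻¹ Φ_f))` (★ Kronecker-currency
factorisation read in `𝒮(𝔸_Fⁿ)` through `piSBReindex F e = R_e^∞ ⊗ R_e^f`). [cite: Weil1964, Chap. III n° 37–38] -/
theorem pairRep_one_finAdelicToAdelic_tmul (b : UnitaryGroup.finAdelic F E c M JW) (Φinf : 𝓢((Fin n → mixedSpace F), ℂ))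
    (Φfin : FinSB F (Fin n)) :
    pairRep F E c N M e JV JW s (1, UnitaryGroup.finAdelicToAdelic F E c M JW b) (piSchwartzBruhatEquiv F (Fin n) (Φinf ⊗ₜ Φfin)) =
      piSchwartzBruhatEquiv F (Fin n) (Φinf ⊗ₜ
        finSBReindex F e (WeilCoinv.finPairRep F E c N M e JV JW hcδ hδ hd hV hW hVd hWd hJV hJW hs (1, b)
          ((finSBReindex F e).symm Φfin))) := by
  have h1 : ((1 : UnitaryGroup.adelic F E c N JV), (UnitaryGroup.finAdelicToAdelic F E c M JW b : UnitaryGroup.adelic F E c M JW)) =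
      WeilCoinv.finPairToAdelic F E c N M JV JW (1, b) :=
    Prod.ext (by change (1 : UnitaryGroup.adelic F E c N JV) = UnitaryGroup.finAdelicToAdelic F E c N JV 1
                 exact (map_one _).symm) rfl
  have key := WeilCoinv.pairRep_finPairToAdelic_piSBReindex_tmul F E c N M e JV JW hcδ hδ hd hV hW hVd hWd hJV hJW hs (1, b)
    (schwartzReindexCLM F e.symm Φinf) ((finSBReindex F e).symm Φfin)
  rw [piSBReindex_tmul, piSBReindex_tmul, schwartzReindexCLM_symm_apply, LinearEquiv.apply_symm_apply] at key
  exact (congrArg (fun p => pairRep F E c N M e JV JW s p (piSchwartzBruhatEquiv F (Fin n) (Φinf ⊗ₜ Φfin))) h1).trans key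

/-- **`hω` — the factorisation of `ω_ψ ∘ s_pair` on `U(W)(𝔸) = U(W)(E⊗ℝ)·U(W)(𝔸_{F,f})`**:
`ω_ψ(s_pair(1, (a,1)·(1,b)))(Φ_∞ ⊗ Φ_f) = archWeilRep s (1,a) Φ_∞ ⊗ R_e^f(finPairRep hs (1,b)((R_e^f)⁻¹ Φ_f))` — exactly the hypothesis
`hω` of ★ `UnitaryDualPair.thetaLift_charCM_tmul_ne_zero_of_finCoeff_ne_zero`, for EVERY compatible splitting of EVERY unitary dual pair
of the tree. [cite: Weil1964, Chap. III n° 37–38] [cite: GelbartRogawski1991, §3.1 Prop. 3.1.1] -/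
theorem pairRep_one_archToAdelic_mul_finAdelicToAdelic_tmul (a : UnitaryGroup.arch F E c M JW) (b : UnitaryGroup.finAdelic F E c M JW)
    (Φinf : 𝓢((Fin n → mixedSpace F), ℂ)) (Φfin : FinSB F (Fin n)) :
    pairRep F E c N M e JV JW s (1, UnitaryGroup.archToAdelic F E c M JW a * UnitaryGroup.finAdelicToAdelic F E c M JW b)
        (piSchwartzBruhatEquiv F (Fin n) (Φinf ⊗ₜ Φfin)) =
      piSchwartzBruhatEquiv F (Fin n)
        (archWeilRep F E c N M JV JW hcδ hδ hd hV hW hVd hWd hJV hJW e s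
            (proj_apply_eq_toSp F E c N M e JV JW hcδ hδ hd hV hW hVd hWd hJV hJW hs) (1, a) Φinf ⊗ₜ
          finSBReindex F e (WeilCoinv.finPairRep F E c N M e JV JW hcδ hδ hd hV hW hVd hWd hJV hJW hs (1, b)
            ((finSBReindex F e).symm Φfin))) := by
  have hmul : ((1 : UnitaryGroup.adelic F E c N JV),
      (UnitaryGroup.archToAdelic F E c M JW a * UnitaryGroup.finAdelicToAdelic F E c M JW b : UnitaryGroup.adelic F E c M JW)) =
      ((1 : UnitaryGroup.adelic F E c N JV), (UnitaryGroup.archToAdelic F E c M JW a : UnitaryGroup.adelic F E c M JW)) *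
        ((1 : UnitaryGroup.adelic F E c N JV), (UnitaryGroup.finAdelicToAdelic F E c M JW b : UnitaryGroup.adelic F E c M JW)) := by
    rw [Prod.mk_mul_mk, one_mul]
  refine (congrArg (fun p => pairRep F E c N M e JV JW s p (piSchwartzBruhatEquiv F (Fin n) (Φinf ⊗ₜ Φfin))) hmul).trans ?_
  refine (LinearMap.congr_fun (map_mul (pairRep F E c N M e JV JW s) _ _) _).trans ?_
  -- `(ω(1,x) * ω(1,y)) X = ω(1,x) (ω(1,y) X)` definitionally; finite half inside, archimedean half outside
  exact (congrArg (pairRep F E c N M e JV JW s ((1 : UnitaryGroup.adelic F E c N JV),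
      (UnitaryGroup.archToAdelic F E c M JW a : UnitaryGroup.adelic F E c M JW)))
    (pairRep_one_finAdelicToAdelic_tmul F E c N M e JV JW hcδ hδ hd hV hW hVd hWd hJV hJW hs b Φinf Φfin)).trans
    (pairRep_one_archToAdelic_tmul F E c N M e JV JW hcδ hδ hd hV hW hVd hWd hJV hJW hs a Φinf _)

/-! ## §2 The non-vanishing reduction with `hω` discharged -/

section Reduction

variable [MeasurableSpace (AdeleRing (𝓞 F) F)] [BorelSpace (AdeleRing (𝓞 F) F)]
  [MeasurableSpace (FiniteAdeleRing (𝓞 F) F)] [BorelSpace (FiniteAdeleRing (𝓞 F) F)]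
  {νX : Measure (Fin n → AdeleRing (𝓞 F) F)} {μE : Measure (Fin n → mixedSpace F)}
  {μfX : Measure (Fin n → FiniteAdeleRing (𝓞 F) F)} {cX : ℝ≥0}
  [MeasurableSpace (UnitaryGroup.adelic F E c M JW)] [MeasurableSpace (UnitaryGroup.arch F E c M JW)]
  [MeasurableSpace (UnitaryGroup.finAdelic F E c M JW)]
  (dh : Measure (UnitaryGroup.adelic F E c M JW)) (μa : Measure (UnitaryGroup.arch F E c M JW))
  (μf : Measure (UnitaryGroup.finAdelic F E c M JW))
  [LocallyCompactSpace (UnitaryGroup.adelic F E c N JV)] [LocallyCompactSpace (UnitaryGroup.adelic F E c M JW)]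
  (hρ : HasThetaMajorants fun (p : UnitaryGroup.adelic F E c N JV × UnitaryGroup.adelic F E c M JW)
    (Φ : piSchwartzBruhat F (Fin n)) => pairRep F E c N M e JV JW s p Φ)
  (SK : Set (piSchwartzBruhat F (Fin n)))
  (hSK : ∀ (h : UnitaryGroup.adelic F E c M JW) (Φ : piSchwartzBruhat F (Fin n)), Φ ∈ SK →
    pairRep F E c N M e JV JW s (1, h) Φ ∈ SK)
  [CompactSpace (UnitaryGroup.adelic F E c N JV ⧸ (UnitaryGroup.toAdelic F E c N JV).range)]
  [(UnitaryGroup.toAdelic F E c M JW).range.Normal]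
  [MeasurableSpace (UnitaryGroup.adelic F E c M JW ⧸ (UnitaryGroup.toAdelic F E c M JW).range)]
  (μ : Measure (UnitaryGroup.adelic F E c M JW ⧸ (UnitaryGroup.toAdelic F E c M JW).range))
  [MeasurableSpace (UnitaryGroup.adelic F E c N JV ⧸ (UnitaryGroup.toAdelic F E c N JV).range)]
  (ν : Measure (UnitaryGroup.adelic F E c N JV ⧸ (UnitaryGroup.toAdelic F E c N JV).range))

/-- **`Θ_{Φ_∞ ⊗ Φ_f}(χ̃) ≠ 0` FROM: Rallis' identity (26) for the pair's datum (`hR`), the character reading `hχw`, an archimedean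
`archWeilRep`-eigenvector `Φ_∞` with `⟨Φ_∞, Ψ_∞⟩_∞ ≠ 0`, and ONE non-zero FINITE Fourier coefficient of `finPairRep hs` read in `𝒮((𝔸_{F,f})ⁿ)`**
— ★ `UnitaryDualPair.thetaLift_charCM_tmul_ne_zero_of_finCoeff_ne_zero` with its factorisation hypothesis `hω` DISCHARGED by §1
(`ω_∞ := archWeilRep s (1, ·)`, `ω_f := R_e^f ∘ finPairRepW hs ∘ (R_e^f)⁻¹`).  Also `Θ_{Ψ_∞ ⊗ Ψ_f}(χ̃) ≠ 0`.
[cite: Li1992, p. 178 and Thm 2.1 (26)–(27) p. 184; §5] [cite: Weil1964, Chap. III n° 37–38, 41] [cite: Liu2021, proof of Prop. 4.13, l. 2145] -/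
theorem thetaLift_charCM_tmul_ne_zero_of_finCoeff_ne_zero [SFinite μE] [SFinite μfX]
    (hνX : νX = cX • (μE.prod μfX).map (piAdeleSplit F (Fin n))) (hcX : cX ≠ 0)
    [BorelSpace (UnitaryGroup.adelic F E c M JW)] [BorelSpace (UnitaryGroup.arch F E c M JW)]
    [BorelSpace (UnitaryGroup.finAdelic F E c M JW)] [dh.IsHaarMeasure] [μa.IsHaarMeasure] [μf.IsHaarMeasure]
    [IsFiniteMeasure μa] [IsFiniteMeasure μ] [μ.IsOpenPosMeasure]
    (hR : (thetaKernelDatum F E c N M e JV JW hcδ hδ hd hV hW hVd hWd hJV hJW s hs hρ SK hSK).RallisInnerProductIdentity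
      (schwartzPairing F (Fin n) νX) dh μ ν)
    (χ : PontryaginDual (UnitaryGroup.adelic F E c M JW ⧸ (UnitaryGroup.toAdelic F E c M JW).range))
    {χinf : UnitaryGroup.arch F E c M JW → ℂ} (hχ : ∀ a, χinf a * conj (χinf a) = 1)
    {wfin : UnitaryGroup.finAdelic F E c M JW → ℂ}
    (hχw : ∀ h : UnitaryGroup.adelic F E c M JW, conj ((χ (QuotientGroup.mk h) : Circle) : ℂ) =
      conj (χinf (UnitaryGroup.archPart F E c M JW h)) * wfin (UnitaryGroup.finPart F E c M JW h))
    {Φinf Ψinf : 𝓢((Fin n → mixedSpace F), ℂ)}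
    (heig : ∀ a, archWeilRep F E c N M JV JW hcδ hδ hd hV hW hVd hWd hJV hJW e s
      (proj_apply_eq_toSp F E c N M e JV JW hcδ hδ hd hV hW hVd hWd hJV hJW hs) (1, a) Φinf = χinf a • Φinf)
    (hΦΨ : ∫ x, Φinf x * conj (Ψinf x) ∂μE ≠ 0) {Φfin Ψfin : FinSB F (Fin n)}
    (hfin : (∫ b, (∫ y, ((finSBReindex F e (WeilCoinv.finPairRep F E c N M e JV JW hcδ hδ hd hV hW hVd hWd hJV hJW hs (1, b)
            ((finSBReindex F e).symm Φfin)) : FinSB F (Fin n)) : (Fin n → FiniteAdeleRing (𝓞 F) F) → ℂ) y *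
          conj ((Ψfin : (Fin n → FiniteAdeleRing (𝓞 F) F) → ℂ) y) ∂μfX) * wfin b ∂μf) ≠ 0) :
    (thetaKernelDatum F E c N M e JV JW hcδ hδ hd hV hW hVd hWd hJV hJW s hs hρ SK hSK).thetaLift μ
        (piSchwartzBruhatEquiv F (Fin n) (Φinf ⊗ₜ Φfin)) (charCM χ) ≠ 0 ∧
      (thetaKernelDatum F E c N M e JV JW hcδ hδ hd hV hW hVd hWd hJV hJW s hs hρ SK hSK).thetaLift μ
        (piSchwartzBruhatEquiv F (Fin n) (Ψinf ⊗ₜ Ψfin)) (charCM χ) ≠ 0 :=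
  UnitaryDualPair.thetaLift_charCM_tmul_ne_zero_of_finCoeff_ne_zero F E c N M e JV JW s dh μa μf
    ((archWeilRep F E c N M JV JW hcδ hδ hd hV hW hVd hWd hJV hJW e s
      (proj_apply_eq_toSp F E c N M e JV JW hcδ hδ hd hV hW hVd hWd hJV hJW hs)).comp (MonoidHom.inr _ _))
    ((finSBReindex F e).conjRingEquiv.toMonoidHom.comp
      (WeilCoinv.finPairRepW F E c N M e JV JW hcδ hδ hd hV hW hVd hWd hJV hJW hs))
    hcδ hδ hd hV hW hVd hWd hJV hJW hs hρ SK hSK μ ν hνX hcX hR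
    (fun a b Φinf' Φfin' =>
      pairRep_one_archToAdelic_mul_finAdelicToAdelic_tmul F E c N M e JV JW hcδ hδ hd hV hW hVd hWd hJV hJW hs a b Φinf' Φfin')
    χ hχ hχw heig hΦΨ hfin

end Reduction

end Summit.HodgeConjecture.HodgeConjecture.Cruxes.H413.ThetaNonvanishing

end
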